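import Literature.NumberTheory.LFunctions.GranvilleSoundararajan2003
import Literature.NumberTheory.LFunctions.PrimeCosineSums
import Mathlib.Analysis.SpecialFunctions.Pow.Asymptotics
import Mathlib.Analysis.SpecialFunctions.Integrals.Basic
import Mathlib.Analysis.PSeries
import Mathlib.NumberTheory.Harmonic.Bounds
import HarnessLib

/-!
# Granville–Soundararajan 2003, Theorem 4 fails for maximisers at the edge of the window

Topic `NumberTheory/LFunctions`; sibling of `GranvilleSoundararajan2003.lean`, which vendors the named
facts of A. Granville, K. Soundararajan, *Decay of mean values of multiplicative functions*, Canad. J.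
Math. 55 (2003), 1191–1230 (arXiv:math/9911246; references.bib key `GranvilleSoundararajan2003`), and of
`GranvilleSoundararajan2003Theorem4Refutation.lean` (which refutes the printed `w`-range:
`GranvilleSoundararajan2003_theorem4_false`).

This file **proves**
`GranvilleSoundararajan2003_theorem4_sqrtRange_false : ¬ GranvilleSoundararajan2003_theorem4_sqrtRange`.
That named fact renders **Theorem 4** (the twisted Lipschitz estimate: with `T = log x` and `y₀` a
point where `max_{|y| ≤ 2T} |F(1+iy)|` is attained,
`|x⁻¹ ∑_{n≤x} f(n) n^{-iy₀} - (w/x) ∑_{n≤x/w} f(n) n^{-iy₀}| ≪ (log 2w/log x)^{1-2/π} log(log x/log 2w)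
 + (log log x)^{1+2(1-2/π)}/(log x)^{1-2/π}`) on the reduced range `x ≥ x₀`, `1 ≤ w ≤ √x`, but — as
printed — for EVERY maximiser `y₀ ∈ [-2 log x, 2 log x]`.  For maximisers at the EDGE of the window the
statement is false; the printed proof (§6, arXiv p. 9) establishes it exactly for `|y₀| ≤ log x` (its
display (6.1), `|F₀(1)| = max_{|y| ≤ log x}|F₀(1+iy)|` with `F₀(s) = F(s+iy₀)`, needs `|y| + |y₀| ≤ 2 log x`;
the opening reduction "if `|y₀| ≥ (log x)/2`, then in view of Theorem 3, the result follows" applies to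
UNtwisted means only).  The corrected statement (maximisers with `|y₀| ≤ log x`) is recorded as
`GranvilleSoundararajan2003_theorem4_central` (`GranvilleSoundararajan2003.lean`) and PROVED
(`GranvilleSoundararajan2003_theorem4_central_holds`, `GranvilleSoundararajanTheorem4Proofs.lean`); it is all
the consumer needs (`MatomakiRadziwillL4A.lipschitz_of_GS_central`, case `|y₀| < 1/100`).  Since the
verdict clean-up of 2026-08-15 the refuted def is `@[deprecated]` in `GranvilleSoundararajan2003.lean`
(statement kept verbatim as the subject of this refutation); the refutation must name it, so the
deprecation linter is switched off on exactly the two declarations below that do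
(`GranvilleSoundararajan2003_theorem4_sqrtRange_false` and its conventional alias
`not_GranvilleSoundararajan2003_theorem4_sqrtRange`).  The modern form of the result, Granville–Harper–
Soundararajan, Compositio Math. 155 (2019), Thm 1.5 (`κ = 1`), normalises outside the sum
(`x^{-1-it₁} ∑_{n≤x} f(n)`, `t₁` a maximiser over `|t| ≤ log x`) and is immune to the example below.

## The witness

`L = log x` large, `δ = L^{-3/4}`, `u = -2L - δ`, `f(n) = n^{iu}` (`powTwist u`: completely
multiplicative, `|f| = 1`).  Then `F(1+iy) = ζ_x(1+i(y-u))` with `ζ_x(1+iτ) = ∏_{p ≤ x}(1 - p^{-1-iτ})^{-1}`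
(`truncEulerProduct_powTwist`), and on the window `τ = y - u ∈ [δ, 4L+δ]`.  Since
`log |ζ_x(1+iτ)| = G(x,τ) + O(1)` with `G(x,τ) = ∑_{p≤x} cos(τ log p)/p` (`abs_log_norm_zetaTrunc_sub_le`),
the estimates of `PrimeCosineSums.lean` (`G(x,δ) ≥ log(1/δ) - C`, `G(x,τ) ≤ log(1/τ) + C` for `τ ≤ 1`,
`G(x,τ) ≤ (log τ)/10 + C` for `τ ≥ 1`) force every maximiser `y₀` to have `t* = y₀ - u ∈ [δ, K₀ δ]`
(`K₀` absolute), i.e. to lie within `K₀ δ` of the edge `-2L`.  The twisted sums are then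
`∑_{n ≤ z} f(n) n^{-iy₀} = ∑_{n≤z} n^{-it*} = z^{1-it*}/(1-it*) + O(1 + t* log z)`
(`norm_sum_cpow_neg_mul_I_sub_le`), so for `w = exp(π/t*)` (`≤ exp(π L^{3/4}) ≤ √x`, and `w^{it*} = -1`)
the left side is `|1 - w^{it*}|/|1-it*| + o(1) = 2/√(1+t*²) + o(1) ≥ 1`, whereas the right side is
`≪ (5L^{-1/4})^{1-2/π}(log K₀ + log L) + (log L)^{1+2(1-2/π)} L^{-(1-2/π)} → 0`.

## Content

* `powTwist u` — the arithmetic function `n ↦ n^{iu}`; `isMultiplicative_powTwist`, `norm_powTwist_le`.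
* `zetaTrunc x τ = ∏_{p ≤ x} (1 - p^{-1-iτ})^{-1}`; `eulerFactor_powTwist`, `truncEulerProduct_powTwist`
  (`F(1+iy) = ζ_x(1+i(y-u))`), `continuous_zetaTrunc`, `norm_zetaTrunc_pos`,
  `abs_log_norm_zetaTrunc_sub_le` (`|log|ζ_x(1+iτ)| - G(x,τ)| ≤ 1`).
* `norm_sum_cpow_neg_mul_I_sub_le` — `‖∑_{n≤z} n^{-it} - z^{1-it}/(1-it)‖ ≤ 2 + |t|(1 + log z)` (`z ≥ 1`),
  by comparison with `∫_1^{⌊z⌋+1} v^{-it} dv` term by term.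
* `GranvilleSoundararajan2003_theorem4_sqrtRange_false` — the refutation (PROVED);
  `not_GranvilleSoundararajan2003_theorem4_sqrtRange` — the same under the conventional `not_<decl>` name.

## References

* A. Granville, K. Soundararajan, *Decay of mean values of multiplicative functions*, Canad. J. Math.
  55 (2003), no. 6, 1191–1230, doi:10.4153/CJM-2003-047-0; arXiv:math/9911246 — Theorem 4 (arXiv
  p. 2), §6 (its proof, arXiv p. 9), (2.7) (arXiv p. 5). [cite: GranvilleSoundararajan2003, Theorem 4 and §6]
* A. Granville, A. J. Harper, K. Soundararajan, *A new proof of Halász's theorem, and its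
  consequences*, Compositio Math. 155 (2019), 126–163, Theorem 1.5.
  [cite: GranvilleHarperSoundararajan2019Compositio, Theorem 1.5]
-/

noncomputable section

open Finset Real Complex MeasureTheory Set Filter Topology

namespace Literature.NumberTheory.LFunctions.GranvilleSoundararajan

/-! ### The witness `f(n) = n^{iu}` -/

/-- The completely multiplicative function `n ↦ n^{iu}` (`u` real) as an arithmetic function.
[cite: GranvilleSoundararajan2003, §1 (the example `f(n) = n^{iα}`)] -/
def powTwist (u : ℝ) : ArithmeticFunction ℂ :=
  ⟨fun n => if n = 0 then 0 else (n : ℂ) ^ ((u : ℂ) * I), by simp⟩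

/-- `powTwist u n = n^{iu}` for `n ≠ 0`. [folklore] -/
theorem powTwist_apply {u : ℝ} {n : ℕ} (hn : n ≠ 0) : powTwist u n = (n : ℂ) ^ ((u : ℂ) * I) := by
  simp [powTwist, hn]

/-- `powTwist u 0 = 0`. [folklore] -/
theorem powTwist_zero (u : ℝ) : powTwist u 0 = 0 := by simp [powTwist]

/-- `n ↦ n^{iu}` is multiplicative. [folklore] -/
theorem isMultiplicative_powTwist (u : ℝ) : (powTwist u).IsMultiplicative := by
  refine ⟨by simp [powTwist], fun {m n} _ => ?_⟩
  rcases eq_or_ne m 0 with hm | hm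
  · simp [hm]
  rcases eq_or_ne n 0 with hn | hn
  · simp [hn]
  rw [powTwist_apply (mul_ne_zero hm hn), powTwist_apply hm, powTwist_apply hn, Nat.cast_mul,
    Complex.natCast_mul_natCast_cpow]

/-- `|n^{iu}| ≤ 1`. [folklore] -/
theorem norm_powTwist_le (u : ℝ) (n : ℕ) : ‖powTwist u n‖ ≤ 1 := by
  rcases eq_or_ne n 0 with hn | hn
  · simp [hn]
  rw [powTwist_apply hn, Complex.norm_natCast_cpow_of_pos (Nat.pos_of_ne_zero hn)]
  simp

/-! ### `p^{-1-iτ}` in polar form -/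

/-- For a positive natural `p` and real `τ`: `p^{-(1+iτ)} = p⁻¹ (cos(τ log p) - i sin(τ log p))`.
[folklore] -/
theorem natCast_cpow_neg_one_add (p : ℕ) (hp : 0 < p) (τ : ℝ) :
    (p : ℂ) ^ (-(1 + (τ : ℂ) * I)) =
      ((p : ℝ)⁻¹ : ℝ) * (Real.cos (τ * Real.log p) - Real.sin (τ * Real.log p) * I) := by
  have hp0 : (p : ℂ) ≠ 0 := by exact_mod_cast hp.ne'
  rw [Complex.cpow_def_of_ne_zero hp0, ← Complex.ofReal_natCast, ← Complex.ofReal_log (by positivity)]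
  rw [show ((Real.log p : ℝ) : ℂ) * -(1 + (τ : ℂ) * I)
      = (-(Real.log p) : ℝ) + ((-(τ * Real.log p) : ℝ)) * I by push_cast; ring]
  rw [Complex.exp_add_mul_I, ← Complex.ofReal_exp, ← Complex.ofReal_cos, ← Complex.ofReal_sin,
    Real.exp_neg, Real.exp_log (by positivity), Real.cos_neg, Real.sin_neg]
  push_cast
  ring

/-- `|p^{-(1+iτ)}| = 1/p`. [folklore] -/
theorem norm_natCast_cpow_neg_one_add (p : ℕ) (hp : 0 < p) (τ : ℝ) :
    ‖(p : ℂ) ^ (-(1 + (τ : ℂ) * I))‖ = (p : ℝ)⁻¹ := by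
  rw [Complex.norm_natCast_cpow_of_pos hp]
  simp [Real.rpow_neg_one]

/-- `Re p^{-(1+iτ)} = cos(τ log p)/p`. [folklore] -/
theorem re_natCast_cpow_neg_one_add (p : ℕ) (hp : 0 < p) (τ : ℝ) :
    ((p : ℂ) ^ (-(1 + (τ : ℂ) * I))).re = Real.cos (τ * Real.log p) / p := by
  rw [natCast_cpow_neg_one_add p hp τ, Complex.re_ofReal_mul]
  simp only [Complex.sub_re, Complex.mul_re, Complex.ofReal_re, Complex.ofReal_im, Complex.I_re,
    Complex.I_im]
  ring

/-! ### The Euler product of `n^{iu}`: `F(1+iy) = ζ_x(1 + i(y-u))` -/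

/-- The truncated zeta product `ζ_x(1+iτ) = ∏_{p ≤ x} (1 - p^{-1-iτ})^{-1}`. [folklore] -/
def zetaTrunc (x τ : ℝ) : ℂ := ∏ p ∈ Nat.primesBelow (⌊x⌋₊ + 1), (1 - (p : ℂ) ^ (-(1 + (τ : ℂ) * I)))⁻¹

/-- Euler factor of `n^{iu}` at `s = 1 + iy`: the geometric series `(1 - p^{-1-i(y-u)})^{-1}`.
[cite: GranvilleSoundararajan2003, Theorem 1 (definition of F)] -/
theorem eulerFactor_powTwist {u : ℝ} {p : ℕ} (hp : 2 ≤ p) (y : ℝ) :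
    eulerFactor (powTwist u) p (1 + y * I) = (1 - (p : ℂ) ^ (-(1 + ((y - u : ℝ) : ℂ) * I)))⁻¹ := by
  have hp0 : p ≠ 0 := by omega
  have hpC : (p : ℂ) ≠ 0 := by exact_mod_cast hp0
  set q : ℂ := (p : ℂ) ^ (-(1 + ((y - u : ℝ) : ℂ) * I)) with hq
  have hqnorm : ‖q‖ < 1 := by
    rw [hq, norm_natCast_cpow_neg_one_add p (by omega)]
    have : (2 : ℝ) ≤ p := by exact_mod_cast hp
    exact inv_lt_one_of_one_lt₀ (by linarith)
  have hterm : ∀ k : ℕ, powTwist u (p ^ k) * (p : ℂ) ^ (-((1 + y * I) * k)) = q ^ k := by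
    intro k
    rw [powTwist_apply (pow_ne_zero k hp0), Nat.cast_pow, ← Complex.natCast_cpow_natCast_mul,
      show (-((1 + (y : ℂ) * I) * k)) = (k : ℂ) * (-(1 + (y : ℂ) * I)) by ring,
      Complex.cpow_nat_mul, Complex.cpow_nat_mul, ← mul_pow, ← Complex.cpow_add _ _ hpC, hq]
    congr 2
    push_cast; ring
  unfold eulerFactor
  simp_rw [hterm]
  exact tsum_geometric_of_norm_lt_one hqnorm

/-- `F(1+iy) = ζ_x(1+i(y-u))` for `f(n) = n^{iu}`. [cite: GranvilleSoundararajan2003, §1] -/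
theorem truncEulerProduct_powTwist (u x y : ℝ) :
    truncEulerProduct (powTwist u) x (1 + y * I) = zetaTrunc x (y - u) := by
  unfold truncEulerProduct zetaTrunc
  refine Finset.prod_congr rfl fun p hp => ?_
  have hp2 : 2 ≤ p := (Nat.mem_primesBelow.mp hp).2.two_le
  rw [eulerFactor_powTwist hp2]

/-- Continuity of `τ ↦ ζ_x(1+iτ)` (a finite product of continuous nonvanishing-denominator factors).
[folklore] -/
theorem continuous_zetaTrunc (x : ℝ) : Continuous fun τ : ℝ => zetaTrunc x τ := by
  unfold zetaTrunc
  refine continuous_finsetProd _ fun p hp => ?_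
  have hp' := (Nat.mem_primesBelow.mp hp).2
  have hp2 : (2 : ℝ) ≤ p := by exact_mod_cast hp'.two_le
  have hpC : (p : ℂ) ≠ 0 := by exact_mod_cast hp'.ne_zero
  have hq : Continuous fun τ : ℝ => (p : ℂ) ^ (-(1 + (τ : ℂ) * I)) :=
    Continuous.const_cpow (by fun_prop) (Or.inl hpC)
  refine (continuous_const.sub hq).inv₀ fun τ => ?_
  have hn : ‖(p : ℂ) ^ (-(1 + (τ : ℂ) * I))‖ ≤ 1 / 2 := by
    rw [norm_natCast_cpow_neg_one_add p hp'.pos, ← one_div]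
    exact one_div_le_one_div_of_le two_pos hp2
  intro h
  have : (1 : ℂ) = (p : ℂ) ^ (-(1 + (τ : ℂ) * I)) := sub_eq_zero.mp h
  have h1 : ‖(1 : ℂ)‖ ≤ 1 / 2 := by rw [this]; exact hn
  norm_num at h1

/-- `log |ζ_x(1+iτ)| = ∑_{p ≤ x} cos(τ log p)/p + O(1)`: precisely
`|log ‖ζ_x(1+iτ)‖ - ∑_{p ≤ x} cos(τ log p)/p| ≤ 1` (from `|log|1-z| + Re z| ≤ |z|²` for `|z| ≤ 1/2` and
`∑_p 1/p² ≤ 1`). [cite: GranvilleSoundararajan2003, (2.7)] -/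
theorem abs_log_norm_zetaTrunc_sub_le (x τ : ℝ) :
    |Real.log ‖zetaTrunc x τ‖ - ∑ p ∈ Nat.primesLE ⌊x⌋₊, Real.cos (τ * Real.log p) / p| ≤ 1 := by
  unfold zetaTrunc
  -- each factor
  have hfac : ∀ p ∈ Nat.primesBelow (⌊x⌋₊ + 1),
      ‖(1 - (p : ℂ) ^ (-(1 + (τ : ℂ) * I)))⁻¹‖ ≠ 0 ∧
      |Real.log ‖(1 - (p : ℂ) ^ (-(1 + (τ : ℂ) * I)))⁻¹‖ - Real.cos (τ * Real.log p) / p|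
        ≤ ((p : ℝ) ^ 2)⁻¹ := by
    intro p hp
    have hp' := (Nat.mem_primesBelow.mp hp).2
    have hp2 : (2 : ℝ) ≤ p := by exact_mod_cast hp'.two_le
    have hp0 : (0 : ℝ) < p := by linarith
    set q : ℂ := (p : ℂ) ^ (-(1 + (τ : ℂ) * I)) with hq
    have hqn : ‖q‖ = (p : ℝ)⁻¹ := norm_natCast_cpow_neg_one_add p hp'.pos τ
    have hqhalf : ‖q‖ ≤ 1 / 2 := by rw [hqn, ← one_div]; exact one_div_le_one_div_of_le two_pos hp2
    have hq1 : ‖q‖ < 1 := by linarith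
    have hne : 1 - q ≠ 0 := by
      intro h
      have : ‖(1 : ℂ)‖ ≤ 1 / 2 := by rw [(sub_eq_zero.mp h)]; exact hqhalf
      norm_num at this
    have hnorm_pos : 0 < ‖1 - q‖ := norm_pos_iff.mpr hne
    refine ⟨by rw [norm_inv]; exact (inv_pos.mpr hnorm_pos).ne', ?_⟩
    -- `log ‖(1-q)⁻¹‖ = - Re log(1 - q)` and `‖log(1-q) + q‖ ≤ ‖q‖²`
    have hlog : Real.log ‖(1 - q)⁻¹‖ = -(Complex.log (1 - q)).re := by
      rw [norm_inv, Real.log_inv, Complex.log_re]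
    have hbound := Complex.norm_log_one_add_sub_self_le (z := -q) (by rwa [norm_neg])
    rw [norm_neg] at hbound
    have hb2 : ‖q‖ ^ 2 * (1 - ‖q‖)⁻¹ / 2 ≤ ‖q‖ ^ 2 := by
      have h1 : (1 - ‖q‖)⁻¹ ≤ 2 := by
        rw [inv_le_comm₀ (by linarith) two_pos]; linarith
      calc ‖q‖ ^ 2 * (1 - ‖q‖)⁻¹ / 2 ≤ ‖q‖ ^ 2 * 2 / 2 := by gcongr
        _ = ‖q‖ ^ 2 := by ring
    have hre : (Complex.log (1 - q) + q).re = (Complex.log (1 - q)).re + Real.cos (τ * Real.log p) / p := by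
      rw [Complex.add_re, hq, re_natCast_cpow_neg_one_add p hp'.pos τ]
    rw [hlog]
    calc |-(Complex.log (1 - q)).re - Real.cos (τ * Real.log p) / p|
        = |(Complex.log (1 - q) + q).re| := by rw [hre, ← abs_neg]; congr 1; ring
      _ ≤ ‖Complex.log (1 - q) + q‖ := Complex.abs_re_le_norm _
      _ = ‖Complex.log (1 + -q) - -q‖ := by congr 1; ring
      _ ≤ ‖q‖ ^ 2 := hbound.trans hb2
      _ = ((p : ℝ) ^ 2)⁻¹ := by rw [hqn, inv_pow]
  rw [norm_prod, Real.log_prod (s := Nat.primesBelow (⌊x⌋₊ + 1)) (fun p hp => (hfac p hp).1)]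
  rw [show Nat.primesLE ⌊x⌋₊ = Nat.primesBelow (⌊x⌋₊ + 1) from rfl, ← Finset.sum_sub_distrib]
  calc |∑ p ∈ Nat.primesBelow (⌊x⌋₊ + 1),
        (Real.log ‖(1 - (p : ℂ) ^ (-(1 + (τ : ℂ) * I)))⁻¹‖ - Real.cos (τ * Real.log p) / p)|
      ≤ ∑ p ∈ Nat.primesBelow (⌊x⌋₊ + 1),
        |Real.log ‖(1 - (p : ℂ) ^ (-(1 + (τ : ℂ) * I)))⁻¹‖ - Real.cos (τ * Real.log p) / p| :=
        Finset.abs_sum_le_sum_abs _ _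
    _ ≤ ∑ p ∈ Nat.primesBelow (⌊x⌋₊ + 1), ((p : ℝ) ^ 2)⁻¹ := Finset.sum_le_sum fun p hp => (hfac p hp).2
    _ ≤ ∑ n ∈ Finset.Ioo 1 (⌊x⌋₊ + 1), ((n : ℝ) ^ 2)⁻¹ := by
        refine Finset.sum_le_sum_of_subset_of_nonneg (fun p hp => ?_) fun n _ _ => by positivity
        have hp' := Nat.mem_primesBelow.mp hp
        exact Finset.mem_Ioo.mpr ⟨hp'.2.one_lt, hp'.1⟩
    _ ≤ 2 / ((1 : ℕ) + 1) := sum_Ioo_inv_sq_le 1 (⌊x⌋₊ + 1)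
    _ = 1 := by norm_num


/-! ### The twisted sums `∑_{n ≤ z} n^{-it} = z^{1-it}/(1-it) + O(1 + |t| log z)` -/

/-- `v^{-it} = exp(-it log v)` for real `v > 0`. [folklore] -/
theorem ofReal_cpow_neg_mul_I_eq_exp {v : ℝ} (hv : 0 < v) (t : ℝ) :
    (v : ℂ) ^ (-((t : ℂ) * I)) = Complex.exp (I * ((-(t * Real.log v) : ℝ) : ℂ)) := by
  rw [Complex.cpow_def_of_ne_zero (by exact_mod_cast hv.ne'), ← Complex.ofReal_log hv.le]
  congr 1
  push_cast
  ring

/-- `|v^{-it}| = 1` for real `v > 0` (private copy of the lemma of the same statement in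
`GranvilleSoundararajanTwistedPlancherel`, to keep the import closure small). [folklore] -/
private theorem norm_ofReal_cpow_neg_ofReal_mul_I {v : ℝ} (hv : 0 < v) (t : ℝ) : ‖(v : ℂ) ^ (-((t : ℂ) * I))‖ = 1 := by
  rw [ofReal_cpow_neg_mul_I_eq_exp hv, mul_comm, Complex.norm_exp_ofReal_mul_I]

/-- Chord bound: `|v^{-it} - n^{-it}| ≤ |t| (log v - log n)` for `0 < n ≤ v`. [folklore] -/
theorem norm_cpow_neg_mul_I_sub_le {n v : ℝ} (hn : 0 < n) (hnv : n ≤ v) (t : ℝ) :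
    ‖(v : ℂ) ^ (-((t : ℂ) * I)) - (n : ℂ) ^ (-((t : ℂ) * I))‖ ≤ |t| * (Real.log v - Real.log n) := by
  have hv : 0 < v := hn.trans_le hnv
  rw [ofReal_cpow_neg_mul_I_eq_exp hv, ofReal_cpow_neg_mul_I_eq_exp hn]
  set a : ℝ := -(t * Real.log v) with ha
  set b : ℝ := -(t * Real.log n) with hb
  have key : Complex.exp (I * (a : ℂ)) - Complex.exp (I * (b : ℂ)) =
      Complex.exp (I * (b : ℂ)) * (Complex.exp (I * ((a - b : ℝ) : ℂ)) - 1) := by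
    rw [mul_sub, mul_one, ← Complex.exp_add]
    congr 1
    push_cast
    ring
  rw [key, norm_mul, mul_comm I (b : ℂ), Complex.norm_exp_ofReal_mul_I, one_mul]
  refine (Real.norm_exp_I_mul_ofReal_sub_one_le).trans ?_
  rw [Real.norm_eq_abs, ha, hb, show -(t * Real.log v) - -(t * Real.log n) = -(t * (Real.log v - Real.log n)) by ring,
    abs_neg, abs_mul, abs_of_nonneg (sub_nonneg.mpr (Real.log_le_log hn hnv))]

/-- The term-by-term comparison `‖n^{-it} - ∫_n^{n+1} v^{-it} dv‖ ≤ |t|/n`. [folklore] -/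
theorem norm_cpow_sub_integral_le {n : ℕ} (hn : 1 ≤ n) (t : ℝ) :
    ‖(n : ℂ) ^ (-((t : ℂ) * I)) - ∫ v in (n : ℝ)..(n : ℝ) + 1, (v : ℂ) ^ (-((t : ℂ) * I))‖ ≤ |t| / n := by
  have hn0 : (0 : ℝ) < n := by exact_mod_cast hn
  have hint : IntervalIntegrable (fun v : ℝ => (v : ℂ) ^ (-((t : ℂ) * I))) volume (n : ℝ) ((n : ℝ) + 1) :=
    intervalIntegral.intervalIntegrable_cpow (Or.inl (by simp))
  have hconst : ∫ _v in (n : ℝ)..(n : ℝ) + 1, (n : ℂ) ^ (-((t : ℂ) * I)) = (n : ℂ) ^ (-((t : ℂ) * I)) := by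
    simp
  have hsub : (n : ℂ) ^ (-((t : ℂ) * I)) - ∫ v in (n : ℝ)..(n : ℝ) + 1, (v : ℂ) ^ (-((t : ℂ) * I)) =
      ∫ v in (n : ℝ)..(n : ℝ) + 1, ((n : ℂ) ^ (-((t : ℂ) * I)) - (v : ℂ) ^ (-((t : ℂ) * I))) := by
    rw [intervalIntegral.integral_sub (by simp) hint, hconst]
  rw [hsub]
  have hbound : ∀ v ∈ Set.uIoc (n : ℝ) ((n : ℝ) + 1),
      ‖(n : ℂ) ^ (-((t : ℂ) * I)) - (v : ℂ) ^ (-((t : ℂ) * I))‖ ≤ |t| / n := by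
    intro v hv
    rw [Set.uIoc_of_le (by linarith)] at hv
    rw [norm_sub_rev, show ((n : ℕ) : ℂ) = ((n : ℝ) : ℂ) by simp]
    refine (norm_cpow_neg_mul_I_sub_le hn0 hv.1.le t).trans ?_
    rw [div_eq_mul_inv]
    refine mul_le_mul_of_nonneg_left ?_ (abs_nonneg _)
    have hv0 : 0 < v := hn0.trans hv.1
    rw [← Real.log_div hv0.ne' hn0.ne']
    calc Real.log (v / n) ≤ v / n - 1 := Real.log_le_sub_one_of_pos (by positivity)
      _ ≤ ((n : ℝ) + 1) / n - 1 := by gcongr; exact hv.2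
      _ = (n : ℝ)⁻¹ := by field_simp; ring
  calc ‖∫ v in (n : ℝ)..(n : ℝ) + 1, ((n : ℂ) ^ (-((t : ℂ) * I)) - (v : ℂ) ^ (-((t : ℂ) * I)))‖
      ≤ |t| / n * |(n : ℝ) + 1 - n| := intervalIntegral.norm_integral_le_of_norm_le_const hbound
    _ = |t| / n := by simp

/-- `‖∑_{n=1}^{N} n^{-it} - ∫_1^{N+1} v^{-it} dv‖ ≤ |t| H_N` (`H_N` the harmonic number). [folklore] -/
theorem norm_sum_cpow_sub_integral_le_harmonic (t : ℝ) (N : ℕ) :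
    ‖∑ n ∈ Finset.Icc 1 N, (n : ℂ) ^ (-((t : ℂ) * I))
        - ∫ v in (1 : ℝ)..(N : ℝ) + 1, (v : ℂ) ^ (-((t : ℂ) * I))‖ ≤ |t| * (harmonic N : ℝ) := by
  induction N with
  | zero => simp
  | succ N ih =>
    have hint : ∀ a b : ℝ, 1 ≤ a → 1 ≤ b →
        IntervalIntegrable (fun v : ℝ => (v : ℂ) ^ (-((t : ℂ) * I))) volume a b :=
      fun a b _ _ => intervalIntegral.intervalIntegrable_cpow (Or.inl (by simp))
    rw [Finset.sum_Icc_succ_top (by omega), harmonic_succ,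
      ← intervalIntegral.integral_add_adjacent_intervals (b := (N : ℝ) + 1)
        (hint _ _ le_rfl (by simp)) (hint _ _ (by simp) (by push_cast; linarith))]
    have hterm := norm_cpow_sub_integral_le (n := N + 1) (by omega) t
    push_cast at hterm ⊢
    calc ‖∑ n ∈ Finset.Icc 1 N, (n : ℂ) ^ (-((t : ℂ) * I)) + ((N : ℂ) + 1) ^ (-((t : ℂ) * I))
          - ((∫ v in (1 : ℝ)..(N : ℝ) + 1, (v : ℂ) ^ (-((t : ℂ) * I)))
              + ∫ v in (N : ℝ) + 1..(N : ℝ) + 1 + 1, (v : ℂ) ^ (-((t : ℂ) * I)))‖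
        = ‖(∑ n ∈ Finset.Icc 1 N, (n : ℂ) ^ (-((t : ℂ) * I))
              - ∫ v in (1 : ℝ)..(N : ℝ) + 1, (v : ℂ) ^ (-((t : ℂ) * I)))
            + (((N : ℂ) + 1) ^ (-((t : ℂ) * I))
              - ∫ v in (N : ℝ) + 1..(N : ℝ) + 1 + 1, (v : ℂ) ^ (-((t : ℂ) * I)))‖ := by
          congr 1; ring
      _ ≤ |t| * (harmonic N : ℝ) + |t| / ((N : ℝ) + 1) := (norm_add_le _ _).trans (add_le_add ih hterm)
      _ = |t| * ((harmonic N : ℝ) + ((N : ℝ) + 1)⁻¹) := by ring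

/-- `∫_a^b v^{-it} dv = (b^{1-it} - a^{1-it})/(1-it)` for `0 < a`, `0 < b`. [folklore] -/
theorem integral_cpow_neg_mul_I {a b : ℝ} (t : ℝ) :
    ∫ v in a..b, (v : ℂ) ^ (-((t : ℂ) * I)) =
      ((b : ℂ) ^ (1 - (t : ℂ) * I) - (a : ℂ) ^ (1 - (t : ℂ) * I)) / (1 - (t : ℂ) * I) := by
  rw [integral_cpow (Or.inl (by simp))]
  congr 2 <;> ring

/-- `|1 - it| ≥ 1`. [folklore] -/
theorem one_le_norm_one_sub_mul_I (t : ℝ) : 1 ≤ ‖(1 : ℂ) - (t : ℂ) * I‖ := by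
  have h : ‖(1 : ℂ) - (t : ℂ) * I‖ ^ 2 = 1 + t ^ 2 := by
    rw [Complex.sq_norm, Complex.normSq_apply]
    simp; ring
  nlinarith [norm_nonneg ((1 : ℂ) - (t : ℂ) * I), sq_nonneg t]

/-- `|1 - it| = √(1+t²)`. [folklore] -/
theorem norm_one_sub_mul_I (t : ℝ) : ‖(1 : ℂ) - (t : ℂ) * I‖ = Real.sqrt (1 + t ^ 2) := by
  rw [← Real.sqrt_sq (norm_nonneg _), Complex.sq_norm, Complex.normSq_apply]
  congr 1; simp; ring

/-- **Partial sums of `n^{-it}`**: for real `z ≥ 1` and `t`,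
`‖∑_{n ≤ z} n^{-it} - z^{1-it}/(1-it)‖ ≤ 2 + |t| (1 + log z)`. [cite: GranvilleSoundararajan2003, §1 ("`(1/x)∑_{n≤x} n^{iα} ∼ x^{iα}/(1+iα)`")] -/
theorem norm_sum_cpow_neg_mul_I_sub_le {z : ℝ} (hz : 1 ≤ z) (t : ℝ) :
    ‖∑ n ∈ Finset.Icc 1 ⌊z⌋₊, (n : ℂ) ^ (-((t : ℂ) * I))
        - (z : ℂ) ^ (1 - (t : ℂ) * I) / (1 - (t : ℂ) * I)‖ ≤ 2 + |t| * (1 + Real.log z) := by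
  set N : ℕ := ⌊z⌋₊ with hN
  have hz0 : 0 < z := by linarith
  have hN1 : 1 ≤ N := Nat.le_floor (by simpa using hz)
  have hNz : (N : ℝ) ≤ z := Nat.floor_le hz0.le
  have hzN : z ≤ (N : ℝ) + 1 := (Nat.lt_floor_add_one z).le
  have hN0 : (0 : ℝ) < N := by exact_mod_cast hN1
  set w : ℂ := 1 - (t : ℂ) * I with hw
  have hw0 : w ≠ 0 := by
    intro h; have := one_le_norm_one_sub_mul_I t; rw [← hw, h, norm_zero] at this; linarith
  have hw1 : 1 ≤ ‖w‖ := one_le_norm_one_sub_mul_I t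
  -- (1) sum vs `∫_1^{N+1}`
  have h1 := norm_sum_cpow_sub_integral_le_harmonic t N
  have h1' : |t| * (harmonic N : ℝ) ≤ |t| * (1 + Real.log z) := by
    refine mul_le_mul_of_nonneg_left ((harmonic_le_one_add_log N).trans ?_) (abs_nonneg _)
    gcongr
  -- (2) `∫_1^{N+1} = ((N+1)^{w} - 1)/w` and `z^{w}/w - ∫_1^{N+1} = 1/w - ∫_z^{N+1}`
  have hI1 : ∫ v in (1 : ℝ)..(N : ℝ) + 1, (v : ℂ) ^ (-((t : ℂ) * I)) =
      ((((N : ℝ) + 1 : ℝ) : ℂ) ^ w - 1) / w := by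
    rw [show ((N : ℝ) + 1 : ℝ) = (N : ℝ) + 1 by rfl, integral_cpow_neg_mul_I t]
    simp [hw]
  have hI2 : ∫ v in z..(N : ℝ) + 1, (v : ℂ) ^ (-((t : ℂ) * I)) =
      ((((N : ℝ) + 1 : ℝ) : ℂ) ^ w - (z : ℂ) ^ w) / w := by
    rw [integral_cpow_neg_mul_I t]
  have hkey : (z : ℂ) ^ w / w - ∫ v in (1 : ℝ)..(N : ℝ) + 1, (v : ℂ) ^ (-((t : ℂ) * I)) =
      1 / w - ∫ v in z..(N : ℝ) + 1, (v : ℂ) ^ (-((t : ℂ) * I)) := by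
    rw [hI1, hI2]; field_simp; ring
  have hI2bound : ‖∫ v in z..(N : ℝ) + 1, (v : ℂ) ^ (-((t : ℂ) * I))‖ ≤ 1 := by
    have hb : ∀ v ∈ Set.uIoc z ((N : ℝ) + 1), ‖(v : ℂ) ^ (-((t : ℂ) * I))‖ ≤ 1 := by
      intro v hv
      rw [Set.uIoc_of_le hzN] at hv
      rw [norm_ofReal_cpow_neg_ofReal_mul_I (hz0.trans hv.1)]
    calc ‖∫ v in z..(N : ℝ) + 1, (v : ℂ) ^ (-((t : ℂ) * I))‖ ≤ 1 * |(N : ℝ) + 1 - z| :=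
          intervalIntegral.norm_integral_le_of_norm_le_const hb
      _ ≤ 1 * 1 := by
          refine mul_le_mul_of_nonneg_left ?_ zero_le_one
          rw [abs_of_nonneg (by linarith)]; linarith
      _ = 1 := one_mul _
  have hinvw : ‖1 / w‖ ≤ 1 := by
    rw [norm_div, norm_one]; exact div_le_one_of_le₀ hw1 (norm_nonneg _)
  -- assemble
  calc ‖∑ n ∈ Finset.Icc 1 N, (n : ℂ) ^ (-((t : ℂ) * I)) - (z : ℂ) ^ w / w‖
      = ‖(∑ n ∈ Finset.Icc 1 N, (n : ℂ) ^ (-((t : ℂ) * I))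
            - ∫ v in (1 : ℝ)..(N : ℝ) + 1, (v : ℂ) ^ (-((t : ℂ) * I)))
          - ((z : ℂ) ^ w / w - ∫ v in (1 : ℝ)..(N : ℝ) + 1, (v : ℂ) ^ (-((t : ℂ) * I)))‖ := by
        congr 1; ring
    _ ≤ ‖∑ n ∈ Finset.Icc 1 N, (n : ℂ) ^ (-((t : ℂ) * I))
            - ∫ v in (1 : ℝ)..(N : ℝ) + 1, (v : ℂ) ^ (-((t : ℂ) * I))‖
          + ‖(z : ℂ) ^ w / w - ∫ v in (1 : ℝ)..(N : ℝ) + 1, (v : ℂ) ^ (-((t : ℂ) * I))‖ :=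
        norm_sub_le _ _
    _ ≤ |t| * (1 + Real.log z) + (1 + 1) := by
        refine add_le_add (h1.trans h1') ?_
        rw [hkey]
        exact (norm_sub_le _ _).trans (add_le_add hinvw hI2bound)
    _ = 2 + |t| * (1 + Real.log z) := by ring


/-! ### Auxiliary identities for the main term -/

/-- `ζ_x(1+iτ) ≠ 0` (each factor `(1 - p^{-1-iτ})^{-1}` has `|p^{-1-iτ}| ≤ 1/2`). [folklore] -/
theorem norm_zetaTrunc_pos (x τ : ℝ) : 0 < ‖zetaTrunc x τ‖ := by
  unfold zetaTrunc
  rw [norm_prod]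
  refine Finset.prod_pos fun p hp => ?_
  have hp' := (Nat.mem_primesBelow.mp hp).2
  have hp2 : (2 : ℝ) ≤ p := by exact_mod_cast hp'.two_le
  rw [norm_inv, inv_pos, norm_pos_iff]
  intro h
  have hn : ‖(p : ℂ) ^ (-(1 + (τ : ℂ) * I))‖ ≤ 1 / 2 := by
    rw [norm_natCast_cpow_neg_one_add p hp'.pos, ← one_div]
    exact one_div_le_one_div_of_le two_pos hp2
  have : ‖(1 : ℂ)‖ ≤ 1 / 2 := by rw [sub_eq_zero.mp h]; exact hn
  norm_num at this

/-- `log |ζ_x(1+iτ)| = G(x,τ) + O(1)` in terms of `PrimeCosineSum.G`. [cite: GranvilleSoundararajan2003, (2.7)] -/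
theorem abs_log_norm_zetaTrunc_sub_G_le (x τ : ℝ) :
    |Real.log ‖zetaTrunc x τ‖ - PrimeCosineSum.G x τ| ≤ 1 :=
  abs_log_norm_zetaTrunc_sub_le x τ

/-- The twisted sums of the witness: `∑_{n ≤ N} n^{iu} n^{-iy₀} = ∑_{n ≤ N} n^{-i(y₀-u)}`. [folklore] -/
theorem sum_powTwist_twist (u y₀ : ℝ) (N : ℕ) :
    ∑ n ∈ Finset.Icc 1 N, powTwist u n * (n : ℂ) ^ (-((y₀ : ℂ) * I)) =
      ∑ n ∈ Finset.Icc 1 N, (n : ℂ) ^ (-(((y₀ - u : ℝ) : ℂ) * I)) := by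
  refine Finset.sum_congr rfl fun n hn => ?_
  have hn1 : n ≠ 0 := by have := (Finset.mem_Icc.mp hn).1; omega
  have hnC : (n : ℂ) ≠ 0 := by exact_mod_cast hn1
  rw [powTwist_apply hn1, ← Complex.cpow_add _ _ hnC]
  congr 1
  push_cast
  ring

/-- `v^{is} = exp(is log v)` for real `v > 0`. [folklore] -/
theorem ofReal_cpow_ofReal_mul_I_eq_exp {v : ℝ} (hv : 0 < v) (s : ℝ) :
    (v : ℂ) ^ ((s : ℂ) * I) = Complex.exp (I * ((s * Real.log v : ℝ) : ℂ)) := by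
  rw [Complex.cpow_def_of_ne_zero (by exact_mod_cast hv.ne'), ← Complex.ofReal_log hv.le]
  congr 1
  push_cast
  ring

/-- `(x/w)^{-it} = x^{-it} w^{it}` for positive reals `x, w`. [folklore] -/
theorem div_cpow_neg_mul_I {x w : ℝ} (hx : 0 < x) (hw : 0 < w) (t : ℝ) :
    (((x / w : ℝ)) : ℂ) ^ (-((t : ℂ) * I)) = (x : ℂ) ^ (-((t : ℂ) * I)) * (w : ℂ) ^ ((t : ℂ) * I) := by
  rw [ofReal_cpow_neg_mul_I_eq_exp (div_pos hx hw), ofReal_cpow_neg_mul_I_eq_exp hx,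
    ofReal_cpow_ofReal_mul_I_eq_exp hw, ← Complex.exp_add, Real.log_div hx.ne' hw.ne']
  congr 1
  push_cast
  ring

/-- For `w = exp(π/t)` (`t ≠ 0`): `w^{it} = e^{iπ} = -1`. [folklore] -/
theorem exp_pi_div_cpow_mul_I {t : ℝ} (ht : t ≠ 0) :
    ((Real.exp (Real.pi / t) : ℝ) : ℂ) ^ ((t : ℂ) * I) = -1 := by
  rw [ofReal_cpow_ofReal_mul_I_eq_exp (Real.exp_pos _), Real.log_exp,
    show t * (Real.pi / t) = Real.pi by field_simp, mul_comm I]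
  exact_mod_cast Complex.exp_pi_mul_I

/-- `exp(L/2) exp(L/2) = exp L` and `exp y ≥ (1 + y/2)²`-type lower bound: `L² ≤ 16 exp(L/2)` for
`L ≥ 0`. [folklore] -/
theorem sq_le_sixteen_mul_exp_half {L : ℝ} (hL : 0 ≤ L) : L ^ 2 ≤ 16 * Real.exp (L / 2) := by
  have h1 : 1 + L / 4 ≤ Real.exp (L / 4) := by have := Real.add_one_le_exp (L / 4); linarith
  have h2 : Real.exp (L / 2) = Real.exp (L / 4) ^ 2 := by
    rw [← Real.exp_nat_mul]; congr 1; ring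
  have h3 : (1 + L / 4) ^ 2 ≤ Real.exp (L / 4) ^ 2 := pow_le_pow_left₀ (by positivity) h1 2
  nlinarith

/-! ### The refutation -/

-- names the `@[deprecated]` fact `GranvilleSoundararajan2003_theorem4_sqrtRange` on purpose: this IS its
-- refutation (verdict clean-up 2026-08-15); REMOVE-WHEN the deprecated def is deleted from
-- `GranvilleSoundararajan2003.lean`.
set_option linter.deprecated false in
set_option maxHeartbeats 1600000 in
/-- **Theorem 4 of Granville–Soundararajan 2003 fails for maximisers at the edge of the window.**
The named fact `GranvilleSoundararajan2003_theorem4_sqrtRange` (Theorem 4 with `1 ≤ w ≤ √x`, `x ≥ x₀`,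
asserted for EVERY maximiser `y₀ ∈ [-2 log x, 2 log x]` of `|F(1+iy)|`) is false.  Witness: `L = log x`
large, `δ = L^{-3/4}`, `f(n) = n^{iu}` with `u = -2L - δ`; then `F(1+iy) = ζ_x(1+i(y-u))`, every
maximiser has `t* = y₀ - u ∈ [δ, K₀ δ]`, and for `w = e^{π/t*}` the twisted means at `x` and `x/w` differ
by `≈ |1 - w^{it*}|/|1 - it*| = 2/√(1+t*²) > 1`, while the right-hand side tends to `0`.
[cite: GranvilleSoundararajan2003, Theorem 4 and §6 (the statement as printed; §6 proves it for `|y₀| ≤ log x`)] -/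
theorem GranvilleSoundararajan2003_theorem4_sqrtRange_false :
    ¬ GranvilleSoundararajan2003_theorem4_sqrtRange := by
  rintro ⟨C, x₀, H⟩
  obtain ⟨C₁, hG1⟩ := PrimeCosineSum.exists_G_ge
  obtain ⟨C₂, hG2, hG3⟩ := PrimeCosineSum.exists_G_le
  -- constants
  set K₀ : ℝ := Real.exp (|C₁| + |C₂| + 2) with hK₀def
  have hK₀1 : 1 ≤ K₀ := Real.one_le_exp (by positivity)
  have hK₀0 : 0 < K₀ := Real.exp_pos _
  have hlogK₀ : Real.log K₀ = |C₁| + |C₂| + 2 := Real.log_exp _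
  have hlogK₀0 : 0 ≤ Real.log K₀ := by rw [hlogK₀]; positivity
  set a : ℝ := 1 - 2 / Real.pi with hadef
  have hpi3 : (3 : ℝ) < Real.pi := Real.pi_gt_three
  have hpi4 : Real.pi < 4 := Real.pi_lt_four
  have ha0 : 0 < a := by
    rw [hadef, sub_pos, div_lt_one Real.pi_pos]; linarith
  have ha1 : a < 1 := by
    rw [hadef]; have : 0 < 2 / Real.pi := by positivity
    linarith
  -- the majorant of the right-hand side
  set ρ : ℝ → ℝ := fun L => (5 * L ^ (-(1 / 4 : ℝ))) ^ a * (Real.log K₀ + Real.log L)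
      + Real.log L ^ (1 + 2 * a) / L ^ a with hρdef
  have hρexp : ∀ L : ℝ, 0 < L → ρ L = (5 : ℝ) ^ a * Real.log K₀ * L ^ (-(a / 4))
      + (5 : ℝ) ^ a * (Real.log L / L ^ (a / 4)) + Real.log L ^ (1 + 2 * a) / L ^ a := by
    intro L hL
    simp only [hρdef]
    rw [Real.mul_rpow (by norm_num) (Real.rpow_nonneg hL.le _), ← Real.rpow_mul hL.le,
      show -(1 / 4 : ℝ) * a = -(a / 4) by ring, Real.rpow_neg hL.le]
    ring
  have hρ : Tendsto ρ atTop (𝓝 0) := by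
    have h1 : Tendsto (fun L : ℝ => (5 : ℝ) ^ a * Real.log K₀ * L ^ (-(a / 4))) atTop (𝓝 0) := by
      have := (tendsto_rpow_neg_atTop (by positivity : 0 < a / 4)).const_mul ((5 : ℝ) ^ a * Real.log K₀)
      simpa using this
    have h2 : Tendsto (fun L : ℝ => (5 : ℝ) ^ a * (Real.log L / L ^ (a / 4))) atTop (𝓝 0) := by
      have := ((isLittleO_log_rpow_atTop (by positivity : 0 < a / 4)).tendsto_div_nhds_zero).const_mul
        ((5 : ℝ) ^ a)
      simpa using this
    have h3 : Tendsto (fun L : ℝ => Real.log L ^ (1 + 2 * a) / L ^ a) atTop (𝓝 0) :=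
      (isLittleO_log_rpow_rpow_atTop (1 + 2 * a) ha0).tendsto_div_nhds_zero
    have h123 := (h1.add h2).add h3
    rw [add_zero, add_zero] at h123
    refine h123.congr' ?_
    filter_upwards [eventually_gt_atTop (0 : ℝ)] with L hL
    rw [hρexp L hL]
  -- eventual conditions on `L = log x`
  have e0 : ∀ᶠ L : ℝ in atTop, 160 ≤ L := eventually_ge_atTop _
  have e1 : ∀ᶠ L : ℝ in atTop, x₀ ≤ Real.exp L := Real.tendsto_exp_atTop.eventually_ge_atTop x₀
  have e2 : ∀ᶠ L : ℝ in atTop, K₀ ≤ L ^ (3 / 4 : ℝ) :=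
    (tendsto_rpow_atTop (by norm_num : (0 : ℝ) < 3 / 4)).eventually_ge_atTop K₀
  have e3 : ∀ᶠ L : ℝ in atTop, 2 * Real.pi ≤ L ^ (1 / 4 : ℝ) :=
    (tendsto_rpow_atTop (by norm_num : (0 : ℝ) < 1 / 4)).eventually_ge_atTop _
  have e5 : ∀ᶠ L : ℝ in atTop, 2 * (|C₁| + |C₂| + 4) ≤ Real.log L :=
    Real.tendsto_log_atTop.eventually_ge_atTop _
  have e6 : ∀ᶠ L : ℝ in atTop, |C| * ρ L < 1 / 2 := by
    have := hρ.const_mul |C|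
    rw [mul_zero] at this
    exact this.eventually (Iio_mem_nhds (by norm_num : (0 : ℝ) < 1 / 2))
  obtain ⟨L, hL160, hx₀, hK₀L, h2pi, hlogL, hCρ⟩ := (e0.and (e1.and (e2.and (e3.and (e5.and e6))))).exists
  /- basic quantities -/
  have hL1 : 1 ≤ L := by linarith
  have hL0 : 0 < L := by linarith
  have hlogL0 : 0 ≤ Real.log L := Real.log_nonneg hL1
  set x : ℝ := Real.exp L with hxdef
  have hx0 : 0 < x := Real.exp_pos L
  have hlogx : Real.log x = L := Real.log_exp L
  have hxe : Real.exp 1 ≤ x := Real.exp_le_exp.mpr hL1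
  have he : (2 : ℝ) < Real.exp 1 := by have := Real.exp_one_gt_d9; linarith
  have hx2 : 2 ≤ x := by linarith
  have hx1 : 1 ≤ x := by linarith
  -- `L = L^{3/4} L^{1/4}`
  have hL34pos : 0 < L ^ (3 / 4 : ℝ) := Real.rpow_pos_of_pos hL0 _
  have hL14pos : 0 < L ^ (1 / 4 : ℝ) := Real.rpow_pos_of_pos hL0 _
  have hLsplit : L = L ^ (3 / 4 : ℝ) * L ^ (1 / 4 : ℝ) := by
    rw [← Real.rpow_add hL0]; norm_num
  have hL34le : L ^ (3 / 4 : ℝ) ≤ L := by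
    calc L ^ (3 / 4 : ℝ) ≤ L ^ (1 : ℝ) := Real.rpow_le_rpow_of_exponent_le hL1 (by norm_num)
      _ = L := Real.rpow_one L
  have hL34ge1 : 1 ≤ L ^ (3 / 4 : ℝ) := Real.one_le_rpow hL1 (by norm_num)
  set δ : ℝ := (L ^ (3 / 4 : ℝ))⁻¹ with hδdef
  have hδ0 : 0 < δ := inv_pos.mpr hL34pos
  have hδ1 : δ ≤ 1 := inv_le_one_of_one_le₀ hL34ge1
  have hδinv : 1 / δ = L ^ (3 / 4 : ℝ) := by rw [hδdef, one_div, inv_inv]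
  have hlogδ : Real.log (1 / δ) = 3 / 4 * Real.log L := by rw [hδinv, Real.log_rpow hL0]
  have hK₀δ : K₀ * δ ≤ 1 := by
    rw [hδdef, ← div_eq_mul_inv, div_le_one hL34pos]; exact hK₀L
  have hπδ : Real.pi / δ ≤ L / 2 := by
    rw [div_eq_mul_inv, hδdef, inv_inv]
    have : Real.pi * L ^ (3 / 4 : ℝ) * 2 ≤ L ^ (3 / 4 : ℝ) * L ^ (1 / 4 : ℝ) := by nlinarith
    rw [← hLsplit] at this; linarith
  set u : ℝ := -2 * L - δ with hudef
  /- the maximiser -/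
  have hcontΦ : Continuous fun y : ℝ => ‖zetaTrunc x (y - u)‖ :=
    ((continuous_zetaTrunc x).comp (continuous_id.sub continuous_const)).norm
  obtain ⟨y₀, hy₀mem, hy₀max⟩ := (isCompact_Icc (a := -2 * L) (b := 2 * L)).exists_isMaxOn
    ⟨-2 * L, by constructor <;> linarith⟩ hcontΦ.continuousOn
  have hy₀abs : |y₀| ≤ 2 * Real.log x := by rw [hlogx]; exact abs_le.mpr ⟨by linarith [hy₀mem.1], hy₀mem.2⟩
  have hmax : ∀ y : ℝ, |y| ≤ 2 * Real.log x →
      ‖truncEulerProduct (powTwist u) x (1 + y * I)‖ ≤ ‖truncEulerProduct (powTwist u) x (1 + y₀ * I)‖ := by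
    intro y hy
    rw [hlogx] at hy
    rw [truncEulerProduct_powTwist, truncEulerProduct_powTwist]
    exact (isMaxOn_iff.mp hy₀max) y ⟨by linarith [(abs_le.mp hy).1], (abs_le.mp hy).2⟩
  /- location of the maximiser: `t := y₀ - u ∈ [δ, K₀ δ]` -/
  set t : ℝ := y₀ - u with htdef
  have htδ : δ ≤ t := by rw [htdef, hudef]; linarith [hy₀mem.1]
  have ht0 : 0 < t := hδ0.trans_le htδ
  have htup : t ≤ 4 * L + 1 := by rw [htdef, hudef]; linarith [hy₀mem.2]
  have hcomp : Real.log ‖zetaTrunc x δ‖ ≤ Real.log ‖zetaTrunc x t‖ := by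
    have h := (isMaxOn_iff.mp hy₀max) (-2 * L) ⟨le_rfl, by linarith⟩
    rw [show -2 * L - u = δ by rw [hudef]; ring] at h
    exact Real.log_le_log (norm_zetaTrunc_pos x δ) h
  have hGδ : Real.log (1 / δ) - C₁ ≤ PrimeCosineSum.G x δ := by
    refine hG1 δ x hδ0 hδ1 ?_
    rw [hδinv, hxdef]; exact Real.exp_le_exp.mpr hL34le
  have hGcomp : PrimeCosineSum.G x δ - 1 ≤ PrimeCosineSum.G x t + 1 := by
    have h1 := abs_le.mp (abs_log_norm_zetaTrunc_sub_G_le x δ)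
    have h2 := abs_le.mp (abs_log_norm_zetaTrunc_sub_G_le x t)
    linarith
  have ht1 : t ≤ 1 := by
    refine le_of_not_gt fun hgt => ?_
    have h3 := hG3 t x hgt.le hx2
    have hlogt : Real.log t ≤ Real.log (4 * L + 2) := Real.log_le_log ht0 (by linarith)
    have hlog6 : Real.log (4 * L + 2) ≤ 2 + Real.log L := by
      have h6 : Real.log (4 * L + 2) ≤ Real.log (6 * L) := Real.log_le_log (by linarith) (by linarith)
      rw [Real.log_mul (by norm_num) hL0.ne'] at h6
      have : Real.log 6 ≤ 2 := by
        rw [Real.log_le_iff_le_exp (by norm_num)]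
        have h1 : (27 / 10 : ℝ) ≤ Real.exp 1 := by have := Real.exp_one_gt_d9; linarith
        have h2 : Real.exp 2 = Real.exp 1 * Real.exp 1 := by rw [← Real.exp_add]; norm_num
        nlinarith
      linarith
    have hC1 : C₁ ≤ |C₁| := le_abs_self _
    have hC2 : C₂ ≤ |C₂| := le_abs_self _
    rw [hlogδ] at hGδ
    linarith
  have htK : t ≤ K₀ * δ := by
    have h2 := hG2 t x ht0 ht1 hx2
    -- `log(1/δ) - log(1/t) ≤ C₁ + C₂ + 2`
    have hkey : Real.log (t / δ) ≤ |C₁| + |C₂| + 2 := by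
      rw [Real.log_div ht0.ne' hδ0.ne']
      have e1 : Real.log (1 / δ) = -Real.log δ := by rw [one_div, Real.log_inv]
      have e2 : Real.log (1 / t) = -Real.log t := by rw [one_div, Real.log_inv]
      have hC1 : C₁ ≤ |C₁| := le_abs_self _
      have hC2 : C₂ ≤ |C₂| := le_abs_self _
      linarith
    have : t / δ ≤ K₀ := by
      rw [hK₀def, ← Real.exp_log (div_pos ht0 hδ0)]
      exact Real.exp_le_exp.mpr hkey
    rwa [div_le_iff₀ hδ0] at this
  /- the scale `w = e^{π/t}` -/
  set w : ℝ := Real.exp (Real.pi / t) with hwdef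
  have hw0 : 0 < w := Real.exp_pos _
  have hw1 : 1 ≤ w := Real.one_le_exp (by positivity)
  have hπt : Real.pi / t ≤ L / 2 := (div_le_div_of_nonneg_left Real.pi_pos.le hδ0 htδ).trans hπδ
  have hwhalf : w ≤ Real.exp (L / 2) := Real.exp_le_exp.mpr hπt
  have hwsq : w ^ 2 ≤ x := by
    rw [hwdef, hxdef, ← Real.exp_nat_mul]
    exact Real.exp_le_exp.mpr (by push_cast; linarith)
  have hwsqrt : w ≤ Real.sqrt x := (Real.le_sqrt' hw0).mpr hwsq
  have hxw1 : 1 ≤ x / w := by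
    rw [le_div_iff₀ hw0, one_mul]
    calc w ≤ w * 1 := (mul_one w).symm.le
      _ ≤ w * w := mul_le_mul_of_nonneg_left hw1 hw0.le
      _ = w ^ 2 := (sq w).symm
      _ ≤ x := hwsq
  have hxw0 : 0 < x / w := div_pos hx0 hw0
  /- apply the purported theorem -/
  have hH := H (powTwist u) (isMultiplicative_powTwist u) (norm_powTwist_le u) x hx₀ y₀ hy₀abs hmax w hw1 hwsqrt
  rw [sum_powTwist_twist, sum_powTwist_twist, hlogx] at hH
  rw [← htdef] at hH
  /- lower bound for the left-hand side -/
  set S : ℝ → ℂ := fun z => ∑ n ∈ Finset.Icc 1 ⌊z⌋₊, (n : ℂ) ^ (-((t : ℂ) * I)) with hSdef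
  set cw : ℂ := 1 - (t : ℂ) * I with hcwdef
  have hcw1 : 1 ≤ ‖cw‖ := one_le_norm_one_sub_mul_I t
  have hcw0 : cw ≠ 0 := by
    intro h; rw [h, norm_zero] at hcw1; linarith
  have hcwle : ‖cw‖ ≤ 10 / 7 := by
    rw [hcwdef, norm_one_sub_mul_I]
    calc Real.sqrt (1 + t ^ 2) ≤ Real.sqrt ((10 / 7) ^ 2) := Real.sqrt_le_sqrt (by nlinarith)
      _ = 10 / 7 := Real.sqrt_sq (by norm_num)
  -- asymptotics of `S`
  have hSx := norm_sum_cpow_neg_mul_I_sub_le hx1 t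
  have hSxw := norm_sum_cpow_neg_mul_I_sub_le hxw1 t
  rw [hlogx, abs_of_pos ht0] at hSx
  rw [abs_of_pos ht0] at hSxw
  have hlogxw : Real.log (x / w) ≤ L := by
    rw [← hlogx]; exact Real.log_le_log hxw0 (div_le_self hx0.le hw1)
  have hlogxw0 : 0 ≤ Real.log (x / w) := Real.log_nonneg hxw1
  have hEx : ‖S x - (x : ℂ) ^ cw / cw‖ ≤ 3 + L := by
    refine hSx.trans ?_
    have : t * (1 + L) ≤ 1 * (1 + L) := mul_le_mul_of_nonneg_right ht1 (by linarith)
    linarith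
  have hExw : ‖S (x / w) - ((x / w : ℝ) : ℂ) ^ cw / cw‖ ≤ 3 + L := by
    refine hSxw.trans ?_
    have : t * (1 + Real.log (x / w)) ≤ 1 * (1 + L) :=
      mul_le_mul ht1 (by linarith) (by linarith) zero_le_one
    linarith
  -- the main terms
  have hxC : (x : ℂ) ≠ 0 := by exact_mod_cast hx0.ne'
  have hxwC : ((x / w : ℝ) : ℂ) ≠ 0 := by exact_mod_cast hxw0.ne'
  have hmain1 : (x : ℂ)⁻¹ * ((x : ℂ) ^ cw / cw) = (x : ℂ) ^ (-((t : ℂ) * I)) / cw := by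
    have hxcw : (x : ℂ) ^ cw = (x : ℂ) * (x : ℂ) ^ (-((t : ℂ) * I)) := by
      rw [hcwdef, sub_eq_add_neg, Complex.cpow_add _ _ hxC, Complex.cpow_one]
    rw [hxcw]
    field_simp
  have hwC : (w : ℂ) ≠ 0 := by exact_mod_cast hw0.ne'
  have hwI : (w : ℂ) ^ ((t : ℂ) * I) = -1 := by
    rw [hwdef]; exact exp_pi_div_cpow_mul_I ht0.ne'
  have hmain2 : ((w / x : ℝ) : ℂ) * (((x / w : ℝ) : ℂ) ^ cw / cw) = -((x : ℂ) ^ (-((t : ℂ) * I)) / cw) := by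
    have hxwcw : ((x / w : ℝ) : ℂ) ^ cw = ((x / w : ℝ) : ℂ) * ((x : ℂ) ^ (-((t : ℂ) * I)) * (w : ℂ) ^ ((t : ℂ) * I)) := by
      rw [hcwdef, sub_eq_add_neg, Complex.cpow_add _ _ hxwC, Complex.cpow_one, div_cpow_neg_mul_I hx0 hw0 t]
    rw [hxwcw, hwI]
    push_cast
    field_simp
  have hnormxt : ‖(x : ℂ) ^ (-((t : ℂ) * I))‖ = 1 := norm_ofReal_cpow_neg_ofReal_mul_I hx0 t
  have hmain_norm : (7 / 5 : ℝ) ≤ ‖(x : ℂ) ^ (-((t : ℂ) * I)) / cw - -((x : ℂ) ^ (-((t : ℂ) * I)) / cw)‖ := by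
    rw [sub_neg_eq_add, ← two_mul, norm_mul, norm_div, hnormxt, Complex.norm_two]
    rw [show (2 : ℝ) * (1 / ‖cw‖) = 2 / ‖cw‖ by ring, le_div_iff₀ (by linarith)]
    linarith
  -- the error terms
  have herr : ‖(x : ℂ)⁻¹ * (S x - (x : ℂ) ^ cw / cw) - ((w / x : ℝ) : ℂ) * (S (x / w) - ((x / w : ℝ) : ℂ) ^ cw / cw)‖
      ≤ 2 / 5 := by
    have hexpL : Real.exp (L / 2) * Real.exp (L / 2) = x := by
      rw [hxdef, ← Real.exp_add]; congr 1; ring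
    have hexphalf0 : 0 < Real.exp (L / 2) := Real.exp_pos _
    have hinvx : x⁻¹ ≤ (Real.exp (L / 2))⁻¹ := by
      refine inv_anti₀ hexphalf0 ?_
      calc Real.exp (L / 2) = Real.exp (L / 2) * 1 := (mul_one _).symm
        _ ≤ Real.exp (L / 2) * Real.exp (L / 2) :=
            mul_le_mul_of_nonneg_left (Real.one_le_exp (by linarith)) hexphalf0.le
        _ = x := hexpL
    have hwx : w / x ≤ (Real.exp (L / 2))⁻¹ := by
      rw [div_le_iff₀ hx0, ← hexpL, ← mul_assoc, inv_mul_cancel₀ hexphalf0.ne', one_mul]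
      exact hwhalf
    have hbound : (3 + L) * (Real.exp (L / 2))⁻¹ ≤ 1 / 5 := by
      rw [← div_eq_mul_inv, div_le_iff₀ hexphalf0]
      have := sq_le_sixteen_mul_exp_half hL0.le
      nlinarith
    calc ‖(x : ℂ)⁻¹ * (S x - (x : ℂ) ^ cw / cw) - ((w / x : ℝ) : ℂ) * (S (x / w) - ((x / w : ℝ) : ℂ) ^ cw / cw)‖
        ≤ ‖(x : ℂ)⁻¹ * (S x - (x : ℂ) ^ cw / cw)‖ + ‖((w / x : ℝ) : ℂ) * (S (x / w) - ((x / w : ℝ) : ℂ) ^ cw / cw)‖ :=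
          norm_sub_le _ _
      _ ≤ x⁻¹ * (3 + L) + (w / x) * (3 + L) := by
          rw [norm_mul, norm_mul, norm_inv, Complex.norm_real, Complex.norm_real, Real.norm_eq_abs,
            Real.norm_eq_abs, abs_of_pos hx0, abs_of_pos (div_pos hw0 hx0)]
          exact add_le_add (mul_le_mul_of_nonneg_left hEx (by positivity)) (mul_le_mul_of_nonneg_left hExw (by positivity))
      _ ≤ (Real.exp (L / 2))⁻¹ * (3 + L) + (Real.exp (L / 2))⁻¹ * (3 + L) := by gcongr
      _ = 2 * ((3 + L) * (Real.exp (L / 2))⁻¹) := by ring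
      _ ≤ 2 * (1 / 5) := by gcongr
      _ = 2 / 5 := by norm_num
  have hLHS : (1 : ℝ) ≤ ‖(x : ℂ)⁻¹ * S x - ((w / x : ℝ) : ℂ) * S (x / w)‖ := by
    set M : ℂ := (x : ℂ) ^ (-((t : ℂ) * I)) / cw - -((x : ℂ) ^ (-((t : ℂ) * I)) / cw) with hMdef
    set E : ℂ := (x : ℂ)⁻¹ * (S x - (x : ℂ) ^ cw / cw)
      - ((w / x : ℝ) : ℂ) * (S (x / w) - ((x / w : ℝ) : ℂ) ^ cw / cw) with hEdef
    have hsplit : (x : ℂ)⁻¹ * S x - ((w / x : ℝ) : ℂ) * S (x / w) = M + E := by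
      rw [hMdef, hEdef, mul_sub, mul_sub, hmain1, hmain2]; ring
    rw [hsplit]
    have key : ‖M‖ ≤ ‖M + E‖ + ‖E‖ := by
      have := norm_add_le (M + E) (-E)
      rwa [add_neg_cancel_right, norm_neg] at this
    linarith
  /- upper bound for the right-hand side -/
  set ℓ : ℝ := Real.log (2 * w) with hℓdef
  have hℓ : ℓ = Real.log 2 + Real.pi / t := by
    rw [hℓdef, Real.log_mul (by norm_num) hw0.ne', hwdef, Real.log_exp]
  have hlog2 : 0 < Real.log 2 := Real.log_pos one_lt_two
  have hlog2' : Real.log 2 < 1 := by have := Real.log_two_lt_d9; linarith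
  have hℓ0 : 0 < ℓ := by rw [hℓ]; positivity
  have hπtup : Real.pi / t ≤ Real.pi * L ^ (3 / 4 : ℝ) := by
    calc Real.pi / t ≤ Real.pi / δ := div_le_div_of_nonneg_left Real.pi_pos.le hδ0 htδ
      _ = Real.pi * L ^ (3 / 4 : ℝ) := by rw [div_eq_mul_inv, hδdef, inv_inv]
  have hπtlow : Real.pi * L ^ (3 / 4 : ℝ) / K₀ ≤ Real.pi / t := by
    rw [div_le_div_iff₀ hK₀0 ht0]
    calc Real.pi * L ^ (3 / 4 : ℝ) * t ≤ Real.pi * L ^ (3 / 4 : ℝ) * (K₀ * δ) :=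
          mul_le_mul_of_nonneg_left htK (by positivity)
      _ = Real.pi * K₀ * (L ^ (3 / 4 : ℝ) * δ) := by ring
      _ = Real.pi * K₀ := by rw [hδdef, mul_inv_cancel₀ hL34pos.ne', mul_one]
  have hℓup : ℓ ≤ 5 * L ^ (3 / 4 : ℝ) := by rw [hℓ]; nlinarith
  have hℓlow : Real.pi * L ^ (3 / 4 : ℝ) / K₀ ≤ ℓ := by rw [hℓ]; linarith
  have h5L : 5 * L ^ (3 / 4 : ℝ) ≤ L := by
    have : 5 ≤ L ^ (1 / 4 : ℝ) := by linarith
    calc 5 * L ^ (3 / 4 : ℝ) ≤ L ^ (1 / 4 : ℝ) * L ^ (3 / 4 : ℝ) := mul_le_mul_of_nonneg_right this hL34pos.le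
      _ = L := by rw [mul_comm, ← hLsplit]
  have hℓL : ℓ ≤ L := hℓup.trans h5L
  have hratio0 : 0 ≤ ℓ / L := div_nonneg hℓ0.le hL0.le
  have hpow : L ^ (3 / 4 : ℝ) / L = L ^ (-(1 / 4 : ℝ)) := by
    rw [div_eq_mul_inv, ← Real.rpow_neg_one L, ← Real.rpow_add hL0]; norm_num
  have hratio : ℓ / L ≤ 5 * L ^ (-(1 / 4 : ℝ)) := by
    calc ℓ / L ≤ 5 * L ^ (3 / 4 : ℝ) / L := div_le_div_of_nonneg_right hℓup hL0.le
      _ = 5 * L ^ (-(1 / 4 : ℝ)) := by rw [mul_div_assoc, hpow]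
  have hlogratio0 : 0 ≤ Real.log (L / ℓ) := Real.log_nonneg ((one_le_div hℓ0).mpr hℓL)
  have hlogratio : Real.log (L / ℓ) ≤ Real.log K₀ + Real.log L := by
    have h34 : L ^ (3 / 4 : ℝ) ≤ K₀ * ℓ := by
      have h := (div_le_iff₀ hK₀0).mp hℓlow
      calc L ^ (3 / 4 : ℝ) ≤ Real.pi * L ^ (3 / 4 : ℝ) := le_mul_of_one_le_left hL34pos.le (by linarith)
        _ ≤ ℓ * K₀ := h
        _ = K₀ * ℓ := mul_comm _ _
    have h1 : L / ℓ ≤ K₀ * L ^ (1 / 4 : ℝ) := by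
      rw [div_le_iff₀ hℓ0]
      calc L = L ^ (3 / 4 : ℝ) * L ^ (1 / 4 : ℝ) := hLsplit
        _ ≤ (K₀ * ℓ) * L ^ (1 / 4 : ℝ) := mul_le_mul_of_nonneg_right h34 hL14pos.le
        _ = K₀ * L ^ (1 / 4 : ℝ) * ℓ := by ring
    calc Real.log (L / ℓ) ≤ Real.log (K₀ * L ^ (1 / 4 : ℝ)) :=
          Real.log_le_log (div_pos hL0 hℓ0) h1
      _ = Real.log K₀ + 1 / 4 * Real.log L := by
          rw [Real.log_mul hK₀0.ne' hL14pos.ne', Real.log_rpow hL0]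
      _ ≤ Real.log K₀ + Real.log L := by linarith
  have hRHSle : (ℓ / L) ^ a * Real.log (L / ℓ) + Real.log L ^ (1 + 2 * a) / L ^ a ≤ ρ L := by
    have hterm1 : (ℓ / L) ^ a * Real.log (L / ℓ) ≤ (5 * L ^ (-(1 / 4 : ℝ))) ^ a * (Real.log K₀ + Real.log L) :=
      mul_le_mul (Real.rpow_le_rpow hratio0 hratio ha0.le) hlogratio hlogratio0
        (Real.rpow_nonneg (by positivity) _)
    simp only [hρdef]
    exact add_le_add hterm1 le_rfl
  have hRHS0 : 0 ≤ (ℓ / L) ^ a * Real.log (L / ℓ) + Real.log L ^ (1 + 2 * a) / L ^ a :=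
    add_nonneg (mul_nonneg (Real.rpow_nonneg hratio0 _) hlogratio0)
      (div_nonneg (Real.rpow_nonneg hlogL0 _) (Real.rpow_nonneg hL0.le _))
  /- the contradiction -/
  have hfinal : (1 : ℝ) ≤ C * ((ℓ / L) ^ a * Real.log (L / ℓ) + Real.log L ^ (1 + 2 * a) / L ^ a) :=
    hLHS.trans hH
  have hup : C * ((ℓ / L) ^ a * Real.log (L / ℓ) + Real.log L ^ (1 + 2 * a) / L ^ a) ≤ |C| * ρ L :=
    (mul_le_mul_of_nonneg_right (le_abs_self C) hRHS0).trans (mul_le_mul_of_nonneg_left hRHSle (abs_nonneg C))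
  have hlt : (1 : ℝ) < 1 / 2 := (hfinal.trans hup).trans_lt hCρ
  norm_num at hlt

-- the alias must name the deprecated def too; REMOVE-WHEN the deprecated def is deleted.
set_option linter.deprecated false in
/-- Conventional name (`not_<decl>`) of the refutation of the deprecated named fact
`GranvilleSoundararajan2003_theorem4_sqrtRange` (= `GranvilleSoundararajan2003_theorem4_sqrtRange_false`).
[cite: GranvilleSoundararajan2003, Theorem 4 (arXiv p. 2) and §6] -/
theorem not_GranvilleSoundararajan2003_theorem4_sqrtRange : ¬ GranvilleSoundararajan2003_theorem4_sqrtRange :=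
  GranvilleSoundararajan2003_theorem4_sqrtRange_false

end Literature.NumberTheory.LFunctions.GranvilleSoundararajan
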